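import Literature.Algebra.Lie.LefschetzTriple
import Literature.Algebra.Lie.KillingBaseChange
import HarnessLib

/-!
# Lefschetz triples, Lefschetz pairs and Jordan–Lefschetz pairs are transported along isomorphisms of Lie algebras
# (Looijenga–Lunts 1997, §1 p. 7, §2 (2.6): "isomorphism class of Jordan–Lefschetz pairs")

Topic `Literature/Algebra/Lie` (namespace `Literature.Algebra.Lie`).  Lane `lit-hodgefound` (Track 2 foundations
library), skeleton seat `lit-hodgefound-skel-1` (generation 38), row **A1-87** of
`run/shared/lean/pub/lit-hodgefound/SKELETON.md`; a theorems-only companion of row A1-84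
(`Literature/Algebra/Lie/LefschetzTriple.lean`).  Looijenga–Lunts classify Jordan–Lefschetz pairs UP TO ISOMORPHISM
((2.6): "every item of this list determines an isomorphism class of Jordan–Lefschetz pairs"); this file proves that the
notions of row A1-84 are indeed invariant under isomorphisms `e : L ≃ₗ⁅K⁆ L'` of Lie algebras: the `ad h`-grading,
simple elements, `𝔰𝔩₂`-triples, the domain and image of `f`, Lefschetz triples `(𝔤, h, 𝔞) ↦ (𝔤', e h, e 𝔞)`, Lefschetz
pairs and Jordan–Lefschetz pairs.  THEOREMS ONLY (no definition, no instance, no named fact, no `sorry`; D-0026 net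
debt `0`).

## Source, VERBATIM (held text `paper:arxiv-alg-geom_9604014`)

> (§1, p0007 L74–L78) "We shall call such a triple a Lefschetz triple and its first two items, `(𝔤, h)`, a Lefschetz
> pair."
> (§2 (2.6), p0010 L28–L29) "Conversely, every item of this list determines an isomorphism class of Jordan–Lefschetz
> pairs."
> (§2, p0009 L109–L110) "Say that a Lefschetz pair `(𝔤, h)` is a Jordan–Lefschetz pair if `(𝔤, h, 𝔤₂)` is a Lefschetz
> triple."

## What is formalised (all `theorem`s, proved; `e : L ≃ₗ⁅K⁆ L'`)

* `mem_adDegree_map_iff` / **`map_adDegree`**: `e(𝔤_k(h)) = 𝔤_k(e h)`;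
* **`isSl2Triple_map`**: `(e h, e x, e y)` is an `𝔰𝔩₂`-triple if `(h, x, y)` is; `isSimpleElement_map`;
* `mem_lefschetzDomain_map`, `mem_lefschetzDuals_map`, `image_lefschetzDuals`: `e` maps the domain / the image of `f`
  of `(h, 𝔞)` into (onto) those of `(e h, e 𝔞)`;
* `isSemisimple_of_lieEquiv` (characteristic `0`, finite dimension: semisimple ⟺ Killing, the tree's
  `KillingBaseChange.isSemisimple_iff_isKilling`, and Mathlib's `LieAlgebra.isKilling_of_equiv`);
* **`IsLefschetzTriple.map`**: `(𝔤, h, 𝔞)` a Lefschetz triple ⇒ `(𝔤', e h, e 𝔞)` a Lefschetz triple;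
  **`IsLefschetzPair.map`**, **`IsJordanLefschetzPair.map`**, and the `iff` versions `isLefschetzPair_map_iff`,
  `isJordanLefschetzPair_map_iff`.

## SCOPE

Characteristic `0` and finite dimension are assumed where semisimplicity is transported (the tree's route semisimple ⟺
Killing); the grading / triple / domain lemmas hold over any commutative ring.  Nothing here concerns complex tori or the
Hodge conjecture.

## References

* [LooijengaLunts1997] E. Looijenga, V. A. Lunts, *A Lie algebra attached to a projective variety*, Invent. Math. 129
  (1997) 361–412; arXiv:alg-geom/9604014. §1 p. 7; §2 (2.6) (held `paper:arxiv-alg-geom_9604014`, p0007, p0009–p0010).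
* [Varadarajan1984] V. S. Varadarajan, *Lie Groups, Lie Algebras, and Their Representations*, GTM 102 (1984), §3.9
  Thm. 3.9.2 (semisimple ⟺ Killing form non-degenerate).
-/

namespace Literature.Algebra.Lie

open Module

/-! ### §1 The grading, triples, domain and image of `f` under an isomorphism -/

section Ring

variable {K : Type*} {L L' : Type*} [CommRing K] [LieRing L] [LieAlgebra K L] [LieRing L'] [LieAlgebra K L']
  (e : L ≃ₗ⁅K⁆ L')

/-- `e u ∈ 𝔤_k(e h) ⟺ u ∈ 𝔤_k(h)`: an isomorphism preserves `ad`-degrees. [cite: LooijengaLunts1997, §1 (1.1) p. 3 ("u has degree k if and only if [h, u] = ku"), §2 (2.6)] -/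
theorem apply_mem_adDegree_iff (h u : L) (k : K) : e u ∈ adDegree K (e h) k ↔ u ∈ adDegree K h k := by
  rw [mem_adDegree_iff, mem_adDegree_iff, ← e.map_lie, ← map_smul]
  exact e.injective.eq_iff

/-- `u' ∈ 𝔤_k(e h) ⟺ e⁻¹ u' ∈ 𝔤_k(h)`. [cite: LooijengaLunts1997, §1 (1.1) p. 3, §2 (2.6)] -/
theorem mem_adDegree_map_iff (h : L) (k : K) (u' : L') : u' ∈ adDegree K (e h) k ↔ e.symm u' ∈ adDegree K h k := by
  rw [← apply_mem_adDegree_iff e h (e.symm u') k, e.apply_symm_apply]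

/-- **`e(𝔤_k(h)) = 𝔤_k(e h)`.** [cite: LooijengaLunts1997, §1 (1.1) p. 3, §2 (2.6)] -/
theorem map_adDegree (h : L) (k : K) :
    (adDegree K h k).map (e : L ≃ₗ[K] L').toLinearMap = adDegree K (e h) k := by
  ext u'
  rw [Submodule.mem_map, mem_adDegree_map_iff]
  constructor
  · rintro ⟨u, hu, rfl⟩
    change e.symm (e u) ∈ _
    rwa [e.symm_apply_apply]
  · intro hu'
    exact ⟨e.symm u', hu', by change e (e.symm u') = u'; exact e.apply_symm_apply u'⟩

/-- **An isomorphism maps `𝔰𝔩₂`-triples to `𝔰𝔩₂`-triples.** [cite: LooijengaLunts1997, §1 (1.1) p. 4, §2 (2.6)] -/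
theorem isSl2Triple_map {h x y : L} (t : IsSl2Triple h x y) : IsSl2Triple (e h) (e x) (e y) where
  h_ne_zero := fun h0 ↦ t.h_ne_zero ((map_eq_zero_iff e (EquivLike.injective e)).1 h0)
  lie_e_f := by rw [← e.map_lie, t.lie_e_f]
  lie_h_e_nsmul := by rw [← e.map_lie, t.lie_h_e_nsmul, map_nsmul]
  lie_h_f_nsmul := by rw [← e.map_lie, t.lie_h_f_nsmul, map_neg, map_nsmul]

/-- … and back: `(e h, e x, e y)` is an `𝔰𝔩₂`-triple iff `(h, x, y)` is. [cite: LooijengaLunts1997, §1 (1.1) p. 4, §2 (2.6)] -/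
theorem isSl2Triple_map_iff {h x y : L} : IsSl2Triple (e h) (e x) (e y) ↔ IsSl2Triple h x y := by
  refine ⟨fun t ↦ ?_, isSl2Triple_map e⟩
  have t' := isSl2Triple_map e.symm t
  rwa [e.symm_apply_apply, e.symm_apply_apply, e.symm_apply_apply] at t'

/-- Simple elements go to simple elements. [cite: LooijengaLunts1997, §1 p. 7 ("a simple element h ∈ 𝔤"), §2 (2.6)] -/
theorem isSimpleElement_map {h : L} (hs : IsSimpleElement h) : IsSimpleElement (e h) := by
  obtain ⟨x, y, t⟩ := hs
  exact ⟨e x, e y, isSl2Triple_map e t⟩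

/-- `e a ∈ e(𝔞) ⟺ a ∈ 𝔞` (for the image submodule). [folklore] [cite: LooijengaLunts1997, §2 (2.6)] -/
theorem apply_mem_map_iff (𝔞 : Submodule K L) (a : L) :
    e a ∈ 𝔞.map (e : L ≃ₗ[K] L').toLinearMap ↔ a ∈ 𝔞 := by
  rw [Submodule.mem_map]
  constructor
  · rintro ⟨b, hb, hba⟩
    have : b = a := e.injective hba
    rwa [← this]
  · exact fun ha ↦ ⟨a, ha, rfl⟩

/-- `u' ∈ e(𝔞) ⟺ e⁻¹ u' ∈ 𝔞`. [folklore] [cite: LooijengaLunts1997, §2 (2.6)] -/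
theorem mem_map_iff_symm_mem (𝔞 : Submodule K L) (u' : L') :
    u' ∈ 𝔞.map (e : L ≃ₗ[K] L').toLinearMap ↔ e.symm u' ∈ 𝔞 := by
  rw [← apply_mem_map_iff e 𝔞 (e.symm u')]
  rw [e.apply_symm_apply]

/-- **`e` maps the domain of `f` of `(h, 𝔞)` onto the domain of `f` of `(e h, e 𝔞)`.** [cite: LooijengaLunts1997, §1 p. 7 ("for e in the domain of f"), §2 (2.6)] -/
theorem apply_mem_lefschetzDomain_iff (h : L) (𝔞 : Submodule K L) (a : L) :
    e a ∈ lefschetzDomain K (e h) (𝔞.map (e : L ≃ₗ[K] L').toLinearMap) ↔ a ∈ lefschetzDomain K h 𝔞 := by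
  constructor
  · rintro ⟨ha, y', t'⟩
    refine ⟨(apply_mem_map_iff e 𝔞 a).1 ha, e.symm y', (isSl2Triple_map_iff e).1 ?_⟩
    rwa [e.apply_symm_apply]
  · rintro ⟨ha, y, t⟩
    exact ⟨(apply_mem_map_iff e 𝔞 a).2 ha, e y, isSl2Triple_map e t⟩

/-- **`e` maps the image of `f` of `(h, 𝔞)` onto the image of `f` of `(e h, e 𝔞)`.** [cite: LooijengaLunts1997, §1 p. 7 ("𝔞 and the image of f"), §2 (2.6)] -/
theorem apply_mem_lefschetzDuals_iff (h : L) (𝔞 : Submodule K L) (y : L) :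
    e y ∈ lefschetzDuals K (e h) (𝔞.map (e : L ≃ₗ[K] L').toLinearMap) ↔ y ∈ lefschetzDuals K h 𝔞 := by
  constructor
  · rintro ⟨a', ha', t'⟩
    refine ⟨e.symm a', (mem_map_iff_symm_mem e 𝔞 a').1 ha', (isSl2Triple_map_iff e).1 ?_⟩
    rwa [e.apply_symm_apply]
  · rintro ⟨a, ha, t⟩
    exact ⟨e a, (apply_mem_map_iff e 𝔞 a).2 ha, isSl2Triple_map e t⟩

/-- `e '' (image of f) = image of f` of the transported pair. [cite: LooijengaLunts1997, §1 p. 7, §2 (2.6)] -/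
theorem image_lefschetzDuals (h : L) (𝔞 : Submodule K L) :
    e '' lefschetzDuals K h 𝔞 = lefschetzDuals K (e h) (𝔞.map (e : L ≃ₗ[K] L').toLinearMap) := by
  ext y'
  constructor
  · rintro ⟨y, hy, rfl⟩
    exact (apply_mem_lefschetzDuals_iff e h 𝔞 y).2 hy
  · intro hy'
    refine ⟨e.symm y', (apply_mem_lefschetzDuals_iff e h 𝔞 _).1 ?_, e.apply_symm_apply y'⟩
    rwa [e.apply_symm_apply]

/-- `e '' 𝔞 = e(𝔞)` as sets. [folklore] [cite: LooijengaLunts1997, §2 (2.6)] -/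
theorem image_coe_submodule (𝔞 : Submodule K L) :
    e '' (𝔞 : Set L) = (𝔞.map (e : L ≃ₗ[K] L').toLinearMap : Set L') := by
  ext u'
  rw [SetLike.mem_coe, mem_map_iff_symm_mem]
  constructor
  · rintro ⟨a, ha, rfl⟩
    rwa [e.symm_apply_apply]
  · intro h
    exact ⟨e.symm u', h, e.apply_symm_apply u'⟩

/-- The Lie subalgebra generated by `e '' s` is everything if the one generated by `s` is. [folklore] [cite: LooijengaLunts1997, §1 p. 7 ((ii) "generated by")] -/
theorem lieSpan_image_eq_top {s : Set L} (hs : LieSubalgebra.lieSpan K L s = ⊤) :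
    LieSubalgebra.lieSpan K L' (e '' s) = ⊤ := by
  refine eq_top_iff.2 fun x' _ ↦ ?_
  have hle : LieSubalgebra.lieSpan K L s ≤ (LieSubalgebra.lieSpan K L' (e '' s)).comap (e : L →ₗ⁅K⁆ L') :=
    LieSubalgebra.lieSpan_le.2 fun x hx ↦ LieSubalgebra.subset_lieSpan ⟨x, hx, rfl⟩
  have hx : e.symm x' ∈ LieSubalgebra.lieSpan K L s := by rw [hs]; exact LieSubalgebra.mem_top _
  have h1 := hle hx
  rw [LieSubalgebra.mem_comap] at h1
  change e (e.symm x') ∈ _ at h1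
  rwa [e.apply_symm_apply] at h1

end Ring

/-! ### §2 Semisimplicity, Lefschetz triples, Lefschetz pairs and Jordan–Lefschetz pairs under an isomorphism -/

section Field

variable {K : Type*} {L L' : Type*} [Field K] [CharZero K] [LieRing L] [LieAlgebra K L] [LieRing L'] [LieAlgebra K L']
  [FiniteDimensional K L] [FiniteDimensional K L']

/-- **Semisimplicity is invariant under isomorphism** (characteristic `0`, finite dimension: semisimple ⟺ the Killing
form is non-degenerate, and the latter is transported by Mathlib's `LieAlgebra.isKilling_of_equiv`).
[cite: Varadarajan1984, §3.9 Thm. 3.9.2] -/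
theorem isSemisimple_of_lieEquiv (e : L ≃ₗ⁅K⁆ L') [LieAlgebra.IsSemisimple K L] : LieAlgebra.IsSemisimple K L' := by
  haveI : LieAlgebra.IsKilling K L := KillingBaseChange.isSemisimple_iff_isKilling.1 ‹_›
  haveI : LieAlgebra.IsKilling K L' := LieAlgebra.isKilling_of_equiv e
  exact KillingBaseChange.isSemisimple_iff_isKilling.2 ‹_›

/-- **LEFSCHETZ TRIPLES ARE TRANSPORTED ALONG ISOMORPHISMS: `(𝔤, h, 𝔞)` a Lefschetz triple ⇒ `(𝔤', e h, e 𝔞)` a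
Lefschetz triple.** [cite: LooijengaLunts1997, §1 p. 7 (Lefschetz triples), §2 (2.6) ("isomorphism class of Jordan–Lefschetz pairs")] -/
theorem IsLefschetzTriple.map (e : L ≃ₗ⁅K⁆ L') {h : L} {𝔞 : Submodule K L} (T : IsLefschetzTriple K h 𝔞) :
    IsLefschetzTriple K (e h) (𝔞.map (e : L ≃ₗ[K] L').toLinearMap) := by
  haveI := T.isSemisimple
  refine ⟨isSemisimple_of_lieEquiv e, ?_, ?_, ?_, ?_⟩
  · -- `e 𝔞 ≤ 𝔤₂(e h)`
    rw [← map_adDegree]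
    exact Submodule.map_mono T.le_adDegree_two
  · -- `e 𝔞` is abelian
    intro a' ha' b' hb'
    obtain ⟨a, ha, rfl⟩ := Submodule.mem_map.1 ha'
    obtain ⟨b, hb, rfl⟩ := Submodule.mem_map.1 hb'
    change ⁅e a, e b⁆ = 0
    rw [← e.map_lie, T.lie_eq_zero a ha b hb, map_zero]
  · -- the domain of `f` is non-empty
    obtain ⟨a, ha⟩ := T.nonempty_lefschetzDomain
    exact ⟨e a, (apply_mem_lefschetzDomain_iff e h 𝔞 a).2 ha⟩
  · -- generation by `e 𝔞` and the image of `f`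
    rw [← image_coe_submodule, ← image_lefschetzDuals, ← Set.image_union]
    exact lieSpan_image_eq_top e T.lieSpan_eq_top

/-- **Lefschetz pairs are transported: `(𝔤, h)` ⇒ `(𝔤', e h)`.** [cite: LooijengaLunts1997, §1 p. 7, §2 (2.6)] -/
theorem IsLefschetzPair.map (e : L ≃ₗ⁅K⁆ L') {h : L} (P : IsLefschetzPair K h) : IsLefschetzPair K (e h) := by
  obtain ⟨𝔞, T⟩ := P
  exact ⟨_, T.map e⟩

/-- **JORDAN–LEFSCHETZ PAIRS ARE TRANSPORTED: `(𝔤, h)` ⇒ `(𝔤', e h)`** (`e(𝔤₂(h)) = 𝔤₂(e h)`).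
[cite: LooijengaLunts1997, §2 p. 9 (Jordan–Lefschetz pair), (2.6) ("every item of this list determines an isomorphism class of Jordan–Lefschetz pairs")] -/
theorem IsJordanLefschetzPair.map (e : L ≃ₗ⁅K⁆ L') {h : L} (J : IsJordanLefschetzPair K h) :
    IsJordanLefschetzPair K (e h) := by
  have T := IsLefschetzTriple.map e J.isLefschetzTriple
  rw [map_adDegree] at T
  exact T

/-- `(𝔤', e h)` is a Lefschetz pair iff `(𝔤, h)` is. [cite: LooijengaLunts1997, §1 p. 7, §2 (2.6)] -/
theorem isLefschetzPair_map_iff (e : L ≃ₗ⁅K⁆ L') {h : L} : IsLefschetzPair K (e h) ↔ IsLefschetzPair K h := by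
  refine ⟨fun P ↦ ?_, fun P ↦ P.map e⟩
  have P' := P.map e.symm
  rwa [e.symm_apply_apply] at P'

/-- `(𝔤', e h)` is a Jordan–Lefschetz pair iff `(𝔤, h)` is. [cite: LooijengaLunts1997, §2 p. 9, (2.6)] -/
theorem isJordanLefschetzPair_map_iff (e : L ≃ₗ⁅K⁆ L') {h : L} :
    IsJordanLefschetzPair K (e h) ↔ IsJordanLefschetzPair K h := by
  refine ⟨fun J ↦ ?_, fun J ↦ J.map e⟩
  have J' := J.map e.symm
  rwa [e.symm_apply_apply] at J'

end Field

end Literature.Algebra.Lie
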